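import Summits.BirchSwinnertonDyer.BirchSwinnertonDyer.Theorems.SignedLowerHalvesKobayashiMainConjectureSmallImageMuTransferCM
import Summits.BirchSwinnertonDyer.BirchSwinnertonDyer.Theorems.SignedLowerHalvesKobayashiMainConjectureSmallImageCMTransferRecordsC
import Summits.BirchSwinnertonDyer.Rank1Residual.SecondDescent.EmptyRecordsThree3Nn01
import Summits.BirchSwinnertonDyer.BirchSwinnertonDyer.Theorems.SignedLowerHalvesKobayashiMainConjectureSmallImageCMTransferMuRecords09
import Summits.BirchSwinnertonDyer.Rank1Residual.Supersingular.X7VisibilityChaNonSurjBall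
import HarnessLib

/-!
# Route `SignedLowerHalves`, crux `KobayashiMainConjectureSmallImage` (item stmt-BirchSwinnertonDyer-19002) —
# L4-PUB per-pair records X (extra roads: second descent / visibility): Kobayashi's ± main conjecture for 2 rank-0 CM-EC-partnered non-surjective pairs
# from PUBLISHED named facts + displayed certificates, NO preprint binder (cell `bsd-ssimc`, seat `bsd-ssimc-k3-c4` gen 4)

HONEST FRAMING: Kobayashi's signed main conjecture at a non-surjective (normaliser-of-non-split-Cartan)
image is OPEN as a class statement; item 4 stays OPEN; nothing here is booked; BSD is not proved by any
of this. These are PER-PAIR theorems. Each one re-derives, for the SAME pair, SAME CM partner and SAME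
kernel-certified congruence as the landed L4-CM record (file `SignedLowerHalvesKobayashiMainConjectureSmallImageCMTransferRecordsC.lean`), the conclusion
`KobayashiMainConjecture W p ε` for BOTH signs — but its closure contains NO preprint: the OPEN binder
`CorpuzLei2025_signedMainConjecture_transfer_OPEN` of the landed record is replaced by PUBLISHED named
facts consumed BY NAME (B. D. Kim 2009 Cor. 2.13 = `BDKim2009.cor213_signedMu_eq_zero_iff_of_torsionIso`;
Kobayashi 2003 Thm. 1.2 and Thm. 4.1 RATIONAL clause; B. D. Kim 2013 Cor. 3.15; Pollack 2003; modularity;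
GZK; Pollack–Rubin 2004; the period-unit facts) plus the pair's own `BSD(E,3)`, which for THIS pair
(`ord₃ #Ш_an = 2`) the tree settles by the b2b lane's flag-free SECOND-DESCENT theorem
`SecondDescent.bsdp3_b1e_155936b1` (Cassels–Tate `hCT` + GZK + `#Sel^(3) = 9` + a Ш-witness of order 3
not divisible by 3 + Cremona's `#Ш_an`), whose binders are passed through and DISPLAYED; and for
`363312bl1 @ 5` (`ord₅ #Ш_an = 2`) by the b2b VISIBILITY theorem `bsdp_x7r0vischabt_363312bl1_5` (Cassels–Tate,
Cha 2005, Tate uniformisation, Fisher 2013 by name + a visible partner model + an `L`-value enclosure + a Heegner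
datum), binders passed through and DISPLAYED. Mechanism (class theorems
`kobayashiMainConjecture_of_cmPartner_of_bsdp_of_analyticRank_eq_zero` /
`…_of_lvalue_of_bsdp_…`, file `…SmallImageMuTransferCM.lean`): Pollack–Rubin + the partner's
`μ(L_p^±(E')) = 0` ⟹ `μ(X^±(E')) = 0` ⟹ (Kim 2009, along the certified `E[p] ≃ E'[p]`) `μ(X^±(E)) = 0` ⟹
Kobayashi's RATIONAL Kato divisibility is INTEGRAL (Gauss' lemma in `Λ`) ⟹ with `r_an = 0` and
`BSD(E,p)` the constant-term squeeze (Kim 2013 + GZK + Kobayashi (3.6) + period units) gives the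
EQUALITY. The partner data (`card_*`, `hasCM_*`) and the Hesse / `c₄`, `c₆` identities are those of the
landed record (imported / re-checked by `norm_num`, `decide`). Non-kernel inputs per pair, all
displayed: the partner certificate (`hL'` unit case / `hμ'` two-engine `μ`-certificate — values and
engines quoted in the landed record's docstring), Cremona's `r_an = 0` and `#Ш_an`, the descent line.

PARTITION (cell bsd-ssimc): X7 (A7) × 2 of item 4's 76 rank-0 CM-EC-partnered pairs —
types-the-object-of (per-pair kernel records at the «published + certificates» tier); closes NONE.

References: [BDKim2009] Cor. 2.13; [Kobayashi2003] Thm. 1.2, Thm. 4.1, (3.6), Conjecture (p. 2);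
[PollackRubin2004] Thm. (p. 448); [BDKim2013] Cor. 3.15; [Fisher2012Hessian] §13; [Cremona2006];
[Miller2011LMS] Def. 1.1; [SchaeferStoll2004] (the descent certificates, via the cited tree theorems).
-/

set_option autoImplicit false
set_option linter.dupNamespace false

noncomputable section

open scoped Classical MatrixGroups ModularForm

open CongruenceSubgroup WeierstrassCurve Literature.NumberTheory.EllipticCurves
  Literature.NumberTheory.EllipticCurves.ModularForms
  Literature.NumberTheory.EllipticCurves.Kobayashi2003 ZpExtension
  Literature.NumberTheory.EllipticCurves.GreenbergVatsal2000
  Literature.NumberTheory.EllipticCurves.BDKim2009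
  Literature.NumberTheory.EllipticCurves.Rank1Residual
  Literature.NumberTheory.EllipticCurves.Rank1Residual.Typed
  Literature.NumberTheory.EllipticCurves.Rank1Residual.X11RankOneCertificates
  Literature.NumberTheory.EllipticCurves.Fisher2012
  Summit.BirchSwinnertonDyer.BirchSwinnertonDyer.Rank1Residual.IntModel
  Summit.BirchSwinnertonDyer.BirchSwinnertonDyer.Rank1Residual.X11RankOne
  Summit.BirchSwinnertonDyer.Rank1Residual.X11b
  Summit.BirchSwinnertonDyer.Rank1Residual.X9
  Summit.BirchSwinnertonDyer.Rank1Residual.X1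
  Summit.BirchSwinnertonDyer.Rank1Residual.Supersingular
  Literature.NumberTheory.EllipticCurves.Wuthrich2014
  Literature.NumberTheory.EllipticCurves.Fisher2016

namespace Summit.BirchSwinnertonDyer.BirchSwinnertonDyer.Theorems

/-- **Kobayashi's ± main conjecture, BOTH signs, for `155936b1 @ 3`** (Cremona model `[0, 0, 0, -28977661, -60052744920]`, analytic rank `0`,
image `3Nn`; the ONE rank-0 CM-partnered item-4 pair at `3` with `ord₃ #Ш_an = 2`) **from PUBLISHED named facts + displayed
certificates, NO preprint.** As the records of `…PubRecordsC.lean` (same partner, same Hesse identity, same `L`-value certificate as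
the landed `kobayashiMainConjecture_c155936b1_3_of_transfer_OPEN`), except that `BSD(E,3)` comes from the tree's flag-free SECOND-DESCENT
theorem `SecondDescent.bsdp3_b1e_155936b1` (`EmptyRecordsThree3Nn01.lean`): Cassels–Tate (`hCT`, PUBLISHED) + GZK + the displayed
certificate lines `hSel9` (`#Sel^(3)(E/ℚ) = 9`), the Ш-witness `c` of order `3` not divisible by `3` (`h3c`, `hndiv`; the b2b lane's
second 3-descent row, quoted in that theorem's docstring) and Cremona's `#Ш_an = s`, `ord₃ s = 2` (`hs`, `hvs`), `r_an = 0` (`hr`).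
Per pair; item 4 stays OPEN; nothing booked; BSD is not proved by any of this.
[cite: BDKim2009, Cor. 2.13 (p. 187)] [cite: PollackRubin2004, Theorem (p. 448) = Thm. 7.3] [cite: Kobayashi2003, Thm. 4.1 (p. 8) and Conjecture (p. 2)]
[cite: Fisher2012Hessian, §13 (analogue of Thm. 13.2 for X_E^-(3))] [cite: Cremona2006, Table 1 (Cremona label 155936b1)] -/
theorem kobayashiMainConjecture_c155936b1_3_of_lvalue_of_bsdp_b1e
    (h09 : cor213_signedMu_eq_zero_iff_of_torsionIso)
    (hPR : PollackRubin2004.mainTheorem_signedCharIdeal_eq_of_cm)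
    (h12 : Kobayashi2003.thm12_signedSelmerDual_finite_torsion)
    (h41 : Kobayashi2003.thm41_signedCharIdeal_divisibility)
    (hKim : BDKim2013.cor315_signedCharValue_rankZero)
    (h5 : realPeriodRat_eq_unit_mul_plusPeriod) (h3 : realPeriodRat_eq_unit_mul_plusPeriod_three)
    (hPollack : ∀ {V : WeierstrassCurve ℚ} [V.IsElliptic] [V.IsGloballyMinimal] {N : ℕ} [NeZero N]
      {g : CuspForm (Gamma0 N) 2} {q : ℕ} [Fact q.Prime],
      pollack_exists_plusMinusPAdicLFunction (W := V) (f := g) (p := q))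
    (hmod : nonempty_modularParametrizationData) (hmod' : hasEntireLFunction_rat)
    (hGZK : rank_eq_analyticRank_of_analyticRank_le_one)
    (hCT : exists_casselsTate_pairing (K := ℚ))
    (W A : WeierstrassCurve ℚ) [W.IsElliptic] [W.IsGloballyMinimal] [A.IsElliptic] [A.IsGloballyMinimal]
    [Fact (Nat.Prime 3)] (hW : W = ⟨0, 0, 0, -28977661, -60052744920⟩) (hA : A = ⟨0, 0, 0, -1, 0⟩)
    (hL' : A.entireLFunction 1 / (A.realPeriodRat : ℂ) = ((1 / 8 : ℚ) : ℂ))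
    (hr : W.analyticRank = 0) (hSel9 : Nat.card (W.selmerGroup (3 : ℤ)) = 9)
    {c : W.sha} (h3c : 3 • c = 0) (hndiv : ∀ d : W.sha, 3 • d ≠ c)
    {s : ℚ} (hs : shaAn W = (s : ℂ)) (hvs : padicValRat 3 s = 2) (ε : ℤˣ) :
    KobayashiMainConjecture W 3 ε := by
  have hIW : integralModelInt W = ⟨0, 0, 0, -28977661, -60052744920⟩ :=
    integralModelInt_eq_of_map_eq _ (by rw [hW]; ext <;> simp [WeierstrassCurve.map])
  have hIA : integralModelInt A = ⟨0, 0, 0, -1, 0⟩ :=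
    integralModelInt_eq_of_map_eq _ (by rw [hA]; ext <;> simp [WeierstrassCurve.map])
  have hΔ : (⟨0, 0, 0, -28977661, -60052744920⟩ : WeierstrassCurve ℤ).Δ = discOf [0, 0, 0, -28977661, -60052744920] :=
    intCurve_Δ 0 0 0 (-28977661) (-60052744920)
  have hΔA : (⟨0, 0, 0, -1, 0⟩ : WeierstrassCurve ℤ).Δ = discOf [0, 0, 0, -1, 0] :=
    intCurve_Δ 0 0 0 (-1) 0
  have hgood : W.HasGoodReductionAtPrime 3 :=
    hasGoodReductionAtPrime_of_not_dvd W 3 (by rw [minimalDiscriminantInt_eq hIW, hΔ]; decide +kernel)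
  have hgoodA : A.HasGoodReductionAtPrime 3 :=
    hasGoodReductionAtPrime_of_not_dvd A 3 (by rw [minimalDiscriminantInt_eq hIA, hΔA]; decide +kernel)
  have hap : W.frobeniusTrace 3 = 0 := by rw [frobeniusTrace_eq hIW card_c155936b1_3]; norm_num
  have hapA : A.frobeniusTrace 3 = 0 := by rw [frobeniusTrace_eq hIA card_cm32a2_3]; norm_num
  have hc4 : W.c₄ = (1390927728 : ℚ) := by
    subst hW; norm_num [WeierstrassCurve.c₄, WeierstrassCurve.b₂, WeierstrassCurve.b₄]
  have hc6 : W.c₆ = (51885571610880 : ℚ) := by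
    subst hW; norm_num [WeierstrassCurve.c₆, WeierstrassCurve.b₂, WeierstrassCurve.b₄, WeierstrassCurve.b₆]
  have hc4A : A.c₄ = (48 : ℚ) := by
    subst hA; norm_num [WeierstrassCurve.c₄, WeierstrassCurve.b₂, WeierstrassCurve.b₄]
  have hc6A : A.c₆ = (0 : ℚ) := by
    subst hA; norm_num [WeierstrassCurve.c₆, WeierstrassCurve.b₂, WeierstrassCurve.b₄, WeierstrassCurve.b₆]
  have hiso := threeCongruent_of_hesseCertificate_unconditional A W ((248 : ℚ) / 15) 1 ((4 : ℚ) / 15)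
    (by norm_num) (by rw [hc4A, hc6A, hc4, eval_hesseC4three]; norm_num)
    (by rw [hc4A, hc6A, hc6, eval_hesseC6three]; norm_num)
  exact kobayashiMainConjecture_of_cmPartner_of_lvalue_of_bsdp_of_analyticRank_eq_zero W A 3 h09 hPR h12
    h41 hKim h5 h3 hPollack hmod hmod' hGZK (by norm_num)
    hgood hap (hasCM_cm32a2 hIA) hgoodA hapA hiso (by norm_num) hL'
    (by rw [show ((1 : ℚ) / 8) = ((1 : ℕ) : ℚ) / (8 : ℕ) by norm_num]
        exact padicValRat_natCast_div_natCast_eq_zero 3 1 8 (by norm_num) (by norm_num)) hr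
    (Summit.BirchSwinnertonDyer.Rank1Residual.SecondDescent.bsdp3_b1e_155936b1 hGZK hCT W hW hr hSel9 h3c hndiv hs
      hvs) ε

/-- **Kobayashi's ± main conjecture, BOTH signs, for `363312bl1 @ 5`** (Cremona model `[0, 0, 0, -23728815, -26430993414]`, analytic rank
`0`, image `5Nn`; the ONE rank-0 CM-partnered item-4 pair at `5` with `ord₅ #Ш_an = 2`) **from PUBLISHED named facts + displayed
certificates, NO preprint.** As the landed `kobayashiMainConjecture_c363312bl1_5_of_mu_of_transfer_OPEN` (MuRecords09: same CM partner
`A : y² = x³ − 97556`, same Hesse identity at `(−696 : 1)`, same displayed two-engine μ-certificate `hμ'`), with `hCL` REPLACED by the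
published block + `BSD(E,5)` from the tree's VISIBILITY theorem `bsdp_x7r0vischabt_363312bl1_5` (`X7VisibilityChaNonSurjBall.lean`, b2b
x10b): its binders are passed through and displayed — Cassels–Tate `hCT`, Cha 2005 `hCha`, Tate uniformisation `hU`/`hU2`, Fisher 2013
Thm 5.8 `hF58` (PUBLISHED, by name), the visible partner model `F` (`hFeq`), the level-one `L`-value enclosure `hball0` for a newform `f` of
`E`, and the Heegner datum (`hK hH hP hnt hpD hpN hI`); plus Cremona's `r_an = 0` (`hr`, also derivable from `hball0` inside that theorem).
Per pair; item 4 stays OPEN; nothing booked; BSD is not proved by any of this.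
[cite: BDKim2009, Cor. 2.13 (p. 187)] [cite: PollackRubin2004, Theorem (p. 448) = Thm. 7.3] [cite: Kobayashi2003, Thm. 4.1 (p. 8) and Conjecture (p. 2)]
[cite: Fisher2012Hessian, Thm. 13.2] [cite: Cremona2006, Table 1 (Cremona label 363312bl1)] -/
theorem kobayashiMainConjecture_c363312bl1_5_of_mu_of_bsdp_vischabt
    (h09 : cor213_signedMu_eq_zero_iff_of_torsionIso)
    (hPR : PollackRubin2004.mainTheorem_signedCharIdeal_eq_of_cm)
    (h12 : Kobayashi2003.thm12_signedSelmerDual_finite_torsion)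
    (h41 : Kobayashi2003.thm41_signedCharIdeal_divisibility)
    (hKim : BDKim2013.cor315_signedCharValue_rankZero)
    (h5 : realPeriodRat_eq_unit_mul_plusPeriod) (h3 : realPeriodRat_eq_unit_mul_plusPeriod_three)
    (hPollack : ∀ {V : WeierstrassCurve ℚ} [V.IsElliptic] [V.IsGloballyMinimal] {N : ℕ} [NeZero N]
      {g : CuspForm (Gamma0 N) 2} {q : ℕ} [Fact q.Prime],
      pollack_exists_plusMinusPAdicLFunction (W := V) (f := g) (p := q))
    (hmod : nonempty_modularParametrizationData) (hmod' : hasEntireLFunction_rat)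
    (hGZK : rank_eq_analyticRank_of_analyticRank_le_one)
    (hCT : exists_casselsTate_pairing (K := ℚ)) (hCha : Cha2005.thm52_padicValNat_shaOrder_le)
    (hU : Silverman1994_thmV53_tateUniformisation.{0})
    (hU2 : Silverman1994_thmV53_corV54_tateUniformisation.{0}) (hF58 : thm58_fiveCongruent_hessePencilInd)
    (hF : thm132_fiveCongruent_hessePencil)
    (W A : WeierstrassCurve ℚ) [W.IsElliptic] [W.IsGloballyMinimal] [A.IsElliptic] [A.IsGloballyMinimal]
    [Fact (Nat.Prime 5)] (hW : W = ⟨0, 0, 0, -23728815, -26430993414⟩) (hA : A = ⟨0, 0, 0, 0, -97556⟩)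
    (hμ' : ∀ [NeZero (A.conductorNorm ℤ)] (f' : CuspForm (Gamma0 (A.conductorNorm ℤ)) 2),
      IsNewformOf A f' → ∀ (Lplus Lminus : IwasawaAlgebra 5), IsPollackPair f' 5 Lplus Lminus →
      ∀ ε : ℤˣ, HasUnitContent (kobayashiL ε Lplus Lminus))
    (hr : W.analyticRank = 0)
    -- the binders of the tree's visibility theorem `bsdp_x7r0vischabt_363312bl1_5`, passed through
    (F : WeierstrassCurve ℚ) [F.IsElliptic] (hFeq : F = ⟨0, 0, 0, -2636535, 978925682⟩)
    {M : ℕ} [NeZero M] (f : CuspForm (Gamma0 M) 2) (hf : IsNewformOf W f)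
    (hball0 : ∃ mid rad : ℝ, rad ≤ 1 / 10 ^ (20 : ℕ) ∧ |mid - ((100 : ℤ) : ℝ)| ≤ 1 / 10 ^ (20 : ℕ) ∧
      |((1 : ℕ) : ℝ) * (((2 : ℕ) : ℝ) * ((W.entireLFunction 1).re / plusPeriod f)) - mid| ≤ rad)
    {N : ℕ} [NeZero N] {K : Type} [Field K] [NumberField K] (hK : IsImaginaryQuadratic K)
    (hH : SatisfiesHeegnerHypothesis N K) {P : (W.baseChange K).toAffine.Point}
    (hP : IsHeegnerPoint N W K P) (hnt : ¬ IsOfFinAddOrder P)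
    (hpD : ¬ (5 : ℤ) ∣ NumberField.discr K) (hpN : ¬ 5 ^ 2 ∣ N)
    (hI : padicValNat 5 (AddSubgroup.zmultiples P).index ≤ 1) (ε : ℤˣ) :
    KobayashiMainConjecture W 5 ε := by
  have hIW : integralModelInt W = ⟨0, 0, 0, -23728815, -26430993414⟩ :=
    integralModelInt_eq_of_map_eq _ (by rw [hW]; ext <;> simp [WeierstrassCurve.map])
  have hIA : integralModelInt A = ⟨0, 0, 0, 0, -97556⟩ :=
    integralModelInt_eq_of_map_eq _ (by rw [hA]; ext <;> simp [WeierstrassCurve.map])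
  have hΔ : (⟨0, 0, 0, -23728815, -26430993414⟩ : WeierstrassCurve ℤ).Δ = discOf [0, 0, 0, -23728815, -26430993414] :=
    intCurve_Δ 0 0 0 (-23728815) (-26430993414)
  have hΔA : (⟨0, 0, 0, 0, -97556⟩ : WeierstrassCurve ℤ).Δ = discOf [0, 0, 0, 0, -97556] :=
    intCurve_Δ 0 0 0 0 (-97556)
  have hgood : W.HasGoodReductionAtPrime 5 :=
    hasGoodReductionAtPrime_of_not_dvd W 5 (by rw [minimalDiscriminantInt_eq hIW, hΔ]; decide +kernel)
  have hgoodA : A.HasGoodReductionAtPrime 5 :=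
    hasGoodReductionAtPrime_of_not_dvd A 5 (by rw [minimalDiscriminantInt_eq hIA, hΔA]; decide +kernel)
  have hap : W.frobeniusTrace 5 = 0 := by rw [frobeniusTrace_eq hIW Summit.BirchSwinnertonDyer.Rank1Residual.Supersingular.card_c363312bl1_5]; norm_num
  have hapA : A.frobeniusTrace 5 = 0 := by rw [frobeniusTrace_eq hIA card_cm0m97556_5]; norm_num
  have hc4 : W.c₄ = (1138983120 : ℚ) := by
    subst hW; norm_num [WeierstrassCurve.c₄, WeierstrassCurve.b₂, WeierstrassCurve.b₄]
  have hc6 : W.c₆ = (22836378309696 : ℚ) := by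
    subst hW; norm_num [WeierstrassCurve.c₆, WeierstrassCurve.b₂, WeierstrassCurve.b₄, WeierstrassCurve.b₆]
  have hc4A : A.c₄ = (0 : ℚ) := by
    subst hA; norm_num [WeierstrassCurve.c₄, WeierstrassCurve.b₂, WeierstrassCurve.b₄]
  have hc6A : A.c₆ = (84288384 : ℚ) := by
    subst hA; norm_num [WeierstrassCurve.c₆, WeierstrassCurve.b₂, WeierstrassCurve.b₄, WeierstrassCurve.b₆]
  have hiso := fiveCongruent_of_hesseCertificate hF A W (-696 : ℚ) 1 (489967701884928 : ℚ)
    (by norm_num) (by rw [hc4A, hc6A, hc4, eval_hesseC4]; norm_num)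
    (by rw [hc4A, hc6A, hc6, eval_hesseC6]; norm_num)
  exact kobayashiMainConjecture_of_cmPartner_of_bsdp_of_analyticRank_eq_zero W A 5 h09 hPR h12 h41 hKim h5
    h3 hPollack hmod hmod' hGZK (by norm_num) hgood hap
    (hasCM_cm0m97556 hIA) ⟨hgoodA, by rw [hapA]; exact dvd_zero _⟩ hapA hiso hμ' hr
    (bsdp_x7r0vischabt_363312bl1_5 hCT hCha hGZK hU hU2 hF58 hW hFeq h5 f hf hball0 hK hH hP hnt hpD hpN hI) ε

end Summit.BirchSwinnertonDyer.BirchSwinnertonDyer.Theorems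

end
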